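import Summits.ABC.IUTFork.Repair.ObstructionSS16
import HarnessLib

/-!
# IUT REPAIR branch, sub-cell B5 — ESCAPE CENSUS VII(a): the SLACK-`s` flip models — door (b″) at EVERY price from the floor up (data, pins, S)

MODEL DATA + proofs (D-0012; toys over abc-iut-c312-7's one-place `toyIndex`, `l⋇ = 2`; no `Prop` fact, nothing asserted about print) of the abc-iut
cell's IUT REPAIR branch (REPAIR-SPEC §4 rows RP-S02 / RP-S05, door (b″); rung LADDER-ABC:A2.RP ⊆ A2.B), seat abc-iut-rp-s2 (gen 3). Part (a) of two; the
results are `ObstructionSS26`. TAKES NO SIDE on [IUTchIII] Cor. 3.12 or on any author (Mochizuki / Scholze–Stix / Joshi / Dupuy–Hilado); typed ≠ proved;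
instantiated ≠ endorsed. Frozen files imported, never edited.

WHY. The bed-free floor of record for a Corollary-preserving supplier of S at honest volumes is a procession-normalised hull inflation of at least
`c(l⋇)·|log(q)|`, `c(l⋇) = PN(j²) − 1 = (2l⋇+5)(l⋇−1)/6` (abc-iut-w4-d103's `PinnedHonest.inflation_of_licence`, `inflationCoeff_eq`; gen 2's
`ObstructionSS18.blur_price_of_S` records the weaker `l⋇²/3`). Gen 2's flip model (`ObstructionSS16`/`SS18`: `μ(tensor log-shell) = 0`) pays `PN(j²)·|log(q)|`
(`5/2` at `l⋇ = 2`) — the floor PLUS `|log(q)|`, its Corollary being strict (`−1 < 0`). THIS FILE re-volumes the SAME bed (`ObstructionSS14`: carrier `ℚ²`,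
Ism `{1, cflip}`, tensor log-shell `tShell`, the (Ind2) flip family) with ONE REAL PARAMETER `s ≥ 0` (the SLACK): `μ_s(tensor log-shell_j) := s − 1`,
`μ_s({q-point}) := −1`, `μ_s({Θ-point}) := −j²` at `j ≥ 1` (`−1` at the junk label `0`), global degree `s − 1`; at `s = 0` the floor is paid EXACTLY
(the TIGHT model), at `s = 1` gen 2's prices are reproduced (inflation `5/2`, strict Corollary `−1 < 0`). Same admissible regions (the tensor log-shell and its
points), same frame `ObstructionSS16.fFrame` = {tensor log-shell, q-point}, same glue, same region reading `ObstructionSS16.rho` (equivariant for the whole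
group), same data `fPsi`/`fqK`. PROVED HERE: `tFull_statement` (typed Thm. 3.11 (i) ∧ (ii) ∧ (iii)), `t_kummerB`, the three pins `t_pinnedRegions3`, and
`t_S` (S through the genuine (Ind2) flip, `ObstructionSS2.S_of_rescaling`). In `ObstructionSS26`: the Corollary holds with slack EXACTLY `s` (`−|log(Θ)| = s − 1`, `−|log(q)| = −1`) and
the hull inflation is EXACTLY `c(2)·|log(q)| + s = 3/2 + s` — at `s = 0` the floor is attained WITH EQUALITY in the Corollary: the floor is SHARP, and
every value above it is the price of some Corollary-preserving supplier of S at honest volumes (the BLUR SPECTRUM `[c(l⋇)·|log(q)|, +∞]`).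
S. Mochizuki, *Inter-universal Teichmüller theory III*, kurims manuscript (May 2020) = `paper:url-4b091feeb646` (cell render); Cor. 3.12 statement
p. 173 l. 41 – p. 174 l. 19, Thm. 3.11 pp. 153–158, Prop. 3.9 (i) p. 115 l. 21–44 (μ^log). [cite: ScholzeStix2018, §2.2 p. 10 l. 26–30] («blurring … of at
least O(ℓ²)», FILE lines) [claim: Mochizuki2012, status: disputed] Standard axioms only.
-/

noncomputable section

open Set

namespace Summit.ABC.IUTFork.Repair.ObstructionSS24

open Thm311 Cor312 Cor312Vol Cor312.Checks Cor312.IdentifiedNonVacuity Cor312Vol.PinnedWitness Cor312Vol.NaiveWitness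
  Literature.IUT.LogThetaLattice ObstructionSS14 ObstructionSS16

/-! ## 1. The tight volume, admissible regions, the data of every vertical line, the columns, the full situation -/

variable (s : ℝ) (j vQ)

open scoped Classical in
/-- **The SLACK-`s` LOG-VOLUME** at label `j` (`s = 0`: the TIGHT volume): the Θ-point `{e₀^{⊗(j+1)}}` has volume `−j²` at `j ≥ 1`; the tensor
log-shell `C_j` has volume `s − 1`; every other region — every other point, in particular the q-point `{e₁^{⊗(j+1)}}`, and the Θ-point at the junk
label `0` — has volume `−1`. Monotone on the admissible regions when `s ≥ 0`; NOT translation-rigid under the cflip (the model's one departure from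
Step (x), as in gen 2's model). MODEL DATA. [claim: Mochizuki2012, status: disputed] -/
def tvol (A : Set (flipShells.Packet j vQ)) : ℝ :=
  if A = {aVec j vQ} ∧ j ≠ 0 then -(((j : ℕ) : ℝ) ^ 2) else if A = tShell j vQ then s - 1 else -1

/-- `μ_s({Θ-vector}) = −j²` at a label `j ≥ 1`. [folklore] -/
theorem tvol_aVec (hj : j ≠ 0) : tvol s j vQ {aVec j vQ} = -(((j : ℕ) : ℝ) ^ 2) := by
  unfold tvol; rw [if_pos ⟨rfl, hj⟩]

/-- `μ_s({x}) = −1` for every other point. [folklore] -/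
theorem tvol_singleton_of_ne {x : flipShells.Packet j vQ} (hx : x ≠ aVec j vQ) : tvol s j vQ {x} = -1 := by
  unfold tvol
  rw [if_neg fun h => hx (Set.singleton_eq_singleton_iff.mp h.1),
    if_neg fun h => not_tShell_subset_singleton j vQ x h.symm.subset]

/-- `μ_s({q-vector}) = −1`. [folklore] -/
theorem tvol_bVec : tvol s j vQ {bVec j vQ} = -1 := tvol_singleton_of_ne s j vQ (aVec_ne_bVec j vQ).symm

/-- `μ_s(C_j) = s − 1`: at `s = 0` the tensor log-shell has the volume of the q-point. [folklore] -/
theorem tvol_tShell : tvol s j vQ (tShell j vQ) = s - 1 := by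
  unfold tvol
  rw [if_neg fun h => not_tShell_subset_singleton j vQ _ h.1.subset, if_pos rfl]

/-- Every point has volume at most `−1` (`−j² ≤ −1` for `j ≥ 1`). [folklore] -/
theorem tvol_singleton_le (x : flipShells.Packet j vQ) : tvol s j vQ {x} ≤ -1 := by
  unfold tvol
  split_ifs with h h'
  · have h1 : (1 : ℝ) ≤ ((j : ℕ) : ℝ) := by exact_mod_cast Nat.one_le_iff_ne_zero.mpr fun h0 => h.2 (Fin.ext h0)
    nlinarith
  · exact absurd h'.symm.subset (not_tShell_subset_singleton j vQ x)
  · exact le_rfl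

variable {j vQ}

/-- **Data (a)(b)(c) of every vertical line** ([IUTchIII] Thm. 3.11 (i)) of the tight model: integral structure the tensor log-shell, admissible
regions the tensor log-shell and its points, log-volume `tvol`, splitting monoid the Θ-datum `ObstructionSS16.fPsi`. MODEL DATA.
[claim: Mochizuki2012, status: disputed] -/
def tData : MRData flipShells where
  shellPk := fun j vQ => tShell j vQ
  shellSub := fun j v => tShell j (toyIndex.over v)
  Adm := fun j vQ A => A = tShell j vQ ∨ ∃ x ∈ tShell j vQ, A = {x}
  logvol := tvol s
  Ψ := fPsi
  act := fun _ _ _ => LinearMap.id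
  Mmod := fun _ => Set.univ

/-- ADMISSIBLE REGIONS of the tight model: the tensor log-shell and its points (unfolding lemma). [folklore] -/
theorem adm_iff (j : toyIndex.Label) (vQ : toyIndex.VQ) (A : Set (flipShells.Packet j vQ)) :
    (tData s).Adm j vQ A ↔ A = tShell j vQ ∨ ∃ x ∈ tShell j vQ, A = {x} := Iff.rfl

/-- The tensor log-shell is admissible. [folklore] -/
theorem adm_tShell (j : toyIndex.Label) (vQ : toyIndex.VQ) : (tData s).Adm j vQ (tShell j vQ) := Or.inl rfl

/-- A point of the tensor log-shell is admissible. [folklore] -/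
theorem adm_singleton (j : toyIndex.Label) (vQ : toyIndex.VQ) {x : flipShells.Packet j vQ} (hx : x ∈ tShell j vQ) :
    (tData s).Adm j vQ {x} := Or.inr ⟨x, hx, rfl⟩

/-- **For `s ≥ 0` the log-volume is MONOTONE on admissible regions** (Prop. 3.9 (i)). [folklore] -/
theorem tvol_mono (hs : 0 ≤ s) (j : toyIndex.Label) (vQ : toyIndex.VQ) {A B : Set (flipShells.Packet j vQ)} (hA : (tData s).Adm j vQ A)
    (hB : (tData s).Adm j vQ B) (hAB : A ⊆ B) : tvol s j vQ A ≤ tvol s j vQ B := by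
  rcases hB with rfl | ⟨y, -, rfl⟩
  · rcases hA with rfl | ⟨x, -, rfl⟩
    · exact le_rfl
    · rw [tvol_tShell]; linarith [tvol_singleton_le s j vQ x]
  · rcases hA with rfl | ⟨x, -, rfl⟩
    · exact absurd hAB (not_tShell_subset_singleton j vQ y)
    · rw [Set.singleton_subset_singleton.mp hAB]

/-- (c)'s global realified Frobenioids: one object, degree `s − 1`, region the tensor log-shell. MODEL DATA. [claim: Mochizuki2012, status: disputed] -/
def tDegrees (j : toyIndex.LabelStar) : GlobalDegrees flipShells j where
  ObjMOD := Unit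
  Objmod := Unit
  natIso := Equiv.refl Unit
  deg := fun _ => s - 1
  region := fun _ vQ => tShell j.1 vQ

/-- The situation of the tight model (all vertical lines carry the same data; an `abbrev`). MODEL DATA. [claim: Mochizuki2012, status: disputed] -/
abbrev tSituation : Situation toyIndex where
  L := flipShells
  D := fun _ => tData s
  G := fun _ j => tDegrees s j

/-- **The column data** ([IUTchIII] Thm. 3.11 (ii)) of the tight model: identity Kummer transport at every `(n, m)` ((ii)(b) by `rfl`), unit-group and
ball images the tensor log-shell, Frobenioid objects abc-iut-w5-d247's tagged copies of `ℤ`, Θ-pilot the object of index `1`. MODEL DATA.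
[claim: Mochizuki2012, status: disputed] -/
def tColumn : Column flipShells where
  frobAdm := fun _ => (tData s).Adm
  frobLogvol := fun _ => tvol s
  frobΨ := fun _ => fPsi
  frobMmod := fun _ _ => Set.univ
  unitImage := fun _ _ j vQ => tShell j vQ
  ballImage := fun _ j vQ => tShell j vQ
  ObjLGP := ℤ
  frobObjLGP := FrobObj
  kumLGP := kum
  ObjLgp := ℤ
  frobObjLgp := FrobObj
  kumLgp := kum
  thetaPilot := fun m => ⟨(1, m), rfl⟩

/-- **The full situation of the tight model** (link data: abc-iut-w5-d247's `naiveLink`). MODEL DATA. [claim: Mochizuki2012, status: disputed] -/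
abbrev tFull : FullSituation toyIndex where
  toSituation := tSituation s
  col := fun _ => tColumn s
  link := naiveLink

/-- **THE TYPED THEOREM 3.11 (i) ∧ (ii) ∧ (iii) HOLDS in the tight model** (`FullSituation.Statement`). [folklore] -/
theorem tFull_statement : (tFull s).Statement := by
  have hI : (tFull s).PartI := by
    refine ⟨fun n v hv x _ j => ?_, fun n j J => ⟨fun vQ => Or.inl rfl, Set.toFinite _, ?_⟩, fun _ _ => rfl⟩
    · show x j ∈ flipShells.SubPacket j.1 v
      rw [ObstructionSS16.subPacket_eq_top]; trivial
    · show s - 1 = ∑ᶠ vQ, tvol s j.1 vQ (tShell j.1 vQ)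
      simp only [tvol_tShell, finsum_unique]
  refine ⟨hI, fun n => ?_, ?_⟩
  · exact (Column.partII_iff _ _).2 ⟨fun m j vQ A hA => ⟨hA, rfl⟩, fun _ _ _ => rfl, fun _ _ => rfl,
      fun _ _ _ _ _ => Set.Subset.rfl, fun _ _ _ h => absurd trivial h⟩
  · refine ⟨naiveLink.partIIIa_holds, naiveLink.partIIIb_holds, ?_, ?_, (tFull s).evalCompatUpToInd_of_multiradialCompat hI.2.2⟩
    · refine naiveLink.partIIIc_of_full (fun _ => rfl) fun n m => ?_
      rintro _ ⟨a, rfl⟩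
      show unitIso a ≪≫ unitIso ((-1) ^ m.natAbs) = unitIso ((-1) ^ m.natAbs) ≪≫ unitIso a
      rw [unitIso_trans, unitIso_trans, mul_comm]
    · intro n m; exact Thm311.PolyIsoCalc.stabilized_full _ _

/-- Thm. 3.11 (ii)(b) for every column of the tight model (identity transport: `rfl`). [folklore] -/
theorem t_kummerB (n : ℤ) : ((tFull s).col n).KummerB ((tFull s).D n) := fun _ _ _ => rfl

/-! ## 2. The pinned setting (frame, glue and region reading of gen 2's model), the pins, S -/

/-- **The PINNED SETTING of the tight model** (column `n = 0`): abc-iut-w4-d101's honest object side (`pinSig`, pilots of exponent `1`, p418585)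
verbatim; frames gen 2's `ObstructionSS16.fFrame` = {tensor log-shell, q-point}; GLUE: the Θ-pilot's `(n,m)`-Kummer image at a label `j ≥ 1` is the
Θ-point, the q-pilot's image the q-point, both the tensor log-shell at the junk label `0`. MODEL DATA. [claim: Mochizuki2012, status: disputed] -/
def tSetting : Setting (tSituation s) where
  n := 0
  HT := ℤ × ℤ
  LogLink := fun _ _ => Unit
  IsFull := fun _ => True
  lattice :=
    { theater := fun n m => (n, m)
      distinct := fun p q h => by simpa using h
      logLink := fun _ _ => ()
      logLink_full := fun _ _ => trivial }
  Frd := Unit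
  IsoF := fun _ _ => Unit
  Ob := fun _ => ℤ
  realify := id
  Strip := Unit
  IsoS := fun _ _ => Unit
  M := fun _ _ => ExpMonoid
  sig := pinSig
  split := { Msplit := fun _ _ => ⊤, exists_gen := fun _ _ => ⟨⟨gen, trivial⟩, top_gen_isGenerator⟩ }
  ObΔ := ℤ
  N := fun _ _ => ExpMonoid
  qData :=
    { q := fun _ _ => gen
      q_gen := fun _ _ => gen_isGenerator
      objOf := fun x => (expOf (x () (Set.mem_univ ())) : ℤ) }
  frame := fun j vQ => fFrame j vQ
  hul_adm := fun j vQ H hH => by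
    rcases hH with rfl | rfl
    · exact adm_tShell s j vQ
    · exact adm_singleton s j vQ (bVec_mem_tShell j vQ)
  thetaRegionOf := fun _ _ j vQ => if j = 0 then tShell j vQ else {aVec j vQ}
  qRegionOf := fun _ j vQ => if j = 0 then tShell j vQ else {bVec j vQ}
  qRegion_mem := fun j vQ => by
    by_cases h : j = 0
    · exact Or.inl (by rw [if_pos h])
    · exact Or.inr (by rw [if_neg h])
  qSupport_finite := fun _ => Set.toFinite _

/-- The Θ-pilot object is the lgp-object of exponent `1`. [folklore] -/
theorem tSetting_thetaPilot : (tSetting s).thetaPilot = (1 : ℤ) :=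
  congrArg (Nat.cast : ℕ → ℤ)
    (expOf_eq_one_of_isGenerator_top (Classical.choose_spec ((tSetting s).split.exists_gen () (Set.mem_univ ()))))

/-- The q-pilot object is the `△`-object of exponent `1`. [folklore] -/
theorem tSetting_qPilot : (tSetting s).qPilot = (1 : ℤ) := rfl

/-- The `(n,m)`-Kummer image of the Θ-pilot: `C_0` at label `0`, the Θ-point at `j ≥ 1`. [folklore] -/
theorem tSetting_thetaRegion (m : ℤ) (j : toyIndex.Label) (vQ : toyIndex.VQ) :
    (tSetting s).thetaRegion m j vQ = if j = 0 then tShell j vQ else {aVec j vQ} := rfl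

/-- The (Ind3)-enlarged Θ-region is the same (constant in `m`). [folklore] -/
theorem tSetting_thetaRegion3 (j : toyIndex.Label) (vQ : toyIndex.VQ) :
    (tSetting s).thetaRegion3 j vQ = if j = 0 then tShell j vQ else {aVec j vQ} := by
  unfold Setting.thetaRegion3
  simp only [tSetting_thetaRegion, Set.iUnion_const]

/-- The image of the q-pilot: `C_0` at label `0`, the q-point at `j ≥ 1`. [folklore] -/
theorem tSetting_qRegion (j : toyIndex.Label) (vQ : toyIndex.VQ) :
    (tSetting s).qRegion j vQ = if j = 0 then tShell j vQ else {bVec j vQ} := rfl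

/-- **THE Θ-PIN** (pΘ) with (hρ) for the whole group (gen 2's `rho`, `rho_equivariant`). [claim: Mochizuki2012, status: disputed] -/
theorem t_thetaPinned : ThetaPinned (tFull s).toLatticeSituation (tSetting s) rho :=
  ⟨fun Φ hΦ X j vQ => rho_equivariant hΦ X j vQ, fun m j vQ => by rw [tSetting_thetaRegion]; exact (rho_fPsi j vQ).symm⟩

/-- **THE q-PIN** (pq′). [claim: Mochizuki2012, status: disputed] -/
theorem t_qPinned : QPinned (tFull s).toLatticeSituation (tSetting s) rho fqK := fun j vQ => by rw [tSetting_qRegion, rho_fqK]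

/-- **(pL) — the link pin** (identity of exponents; pilots of exponent `1`). [folklore] -/
theorem t_linkPinned : LinkPinned (tFull s).toLatticeSituation (tSetting s) :=
  ⟨Equiv.refl ℤ, by rw [tSetting_thetaPilot, tSetting_qPilot]; rfl⟩

/-- **`PinnedRegions3` HOLDS in the tight model.** [claim: Mochizuki2012, status: disputed] -/
theorem t_pinnedRegions3 : PinnedRegions3 (tFull s).toLatticeSituation (tSetting s) rho fqK :=
  ⟨⟨t_thetaPinned s, t_qPinned s⟩, t_linkPinned s⟩

/-- **S HOLDS**: `PilotKummerIndRelated` at the tight model, through the GENUINE (Ind2) flip (`ObstructionSS2.S_of_rescaling`, gen 2's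
`flipFam_carries`). [claim: Mochizuki2012, status: disputed] -/
theorem t_S : PilotKummerIndRelated (tFull s).toLatticeSituation (tSetting s) rho fqK :=
  ObstructionSS2.S_of_rescaling (tFull s).toLatticeSituation (tSetting s) rho fqK (t_thetaPinned s) flipFam_mem_closure flipFam_carries

/-- The residual holds in its DATUM-LEVEL inline form too (abc-iut-w5-d068's `PilotKummerCompat`): the q-datum IS the flip-transport of the column-`0`
Θ-datum. [claim: Mochizuki2012, status: disputed] -/
theorem t_pilotKummerCompat : PilotKummerCompat (tFull s).toLatticeSituation (tSetting s) fqK :=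
  ⟨flipFam, flipFam_mem_closure, 0, fun v _ => by
    show ({qVec v} : Set (flipShells.StarPacket v)) = flipShells.starAut flipFam v '' {thetaVec v}
    rw [Set.image_singleton]
    congr 1
    funext j
    exact (flipFam_aVec j.1 (toyIndex.over v)).symm⟩

end Summit.ABC.IUTFork.Repair.ObstructionSS24

end
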